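import Mathlib.RingTheory.Localization.Away.Basic
import Summits.KontsevichZagierPeriods.KontsevichZagierPeriods.Theses.LiouvilleUnfolding
import Summits.KontsevichZagierPeriods.KontsevichZagierPeriods.Theorems.VietaFibreKernelFormItemDictionary
import Literature.NumberTheory.Transcendental.KZRulesAssociator

/-!
# Item stmt-KontsevichZagierPeriods-0541 (`LiouvilleUnfolding.AyoubPiLocalKernel`) is Ayoub's
# Conjecture 7 verbatim: evaluation is injective on the formal effective period ring with `[π]` inverted

Support file (`--supports` stmt-KontsevichZagierPeriods-0541). J. Ayoub, *Periods and the conjectures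
of Grothendieck and Kontsevich–Zagier*, EMS Newsl. 91 (2014), Def. 6 / Conj. 7, sets
`P_KZ := P^eff_KZ[(2πi)⁻¹]` and conjectures that the evaluation `Ev : P_KZ → ℂ` is injective; the item
(filed in interface typing, `= KZ.PiLocalKernel`: every formal combination of value `0` is killed
modulo the four moves by a power of the disc `[π]`) is the transcription of that conjecture to the
calculus of `KZCalculus.lean`, with the real period `[π]` for `2πi`. This file makes the transcription
LITERAL in Mathlib's language over the commutative ring `P := KZ.FormalPeriodRing = FormalRep ⧸ relations`
(`KZRulesAssociator.lean`: quotient map `KZ.toFormalPeriod`, evaluation `KZ.evalP : P →+* ℝ`), with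
`p := KZ.toFormalPeriod (KZ.of KZ.piRep)` the class of the disc and `P[p⁻¹] := Localization.Away p`:

* `piLocalKernel_iff_forall_evalP` — `KZ.PiLocalKernel ↔ ∀ x : P, evalP x = 0 → ∃ N, p ^ N * x = 0`
  (the kernel of evaluation is `p`-power torsion);
* `piLocalKernel_iff_ker_evalP_eq_ker_algebraMap` — `KZ.PiLocalKernel ↔ ker evalP = ker (P → P[p⁻¹])`
  ("what evaluates to `0` is exactly what dies when `[π]` is inverted"; `⊇` is soundness);
* `exists_ringHom_away_comp_eq_evalP` — `evalP` extends (uniquely) to `Ev : P[p⁻¹] →+* ℝ`, since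
  `evalP p = π ≠ 0`;
* `piLocalKernel_iff_injective_away` — **`KZ.PiLocalKernel ↔` every such extension `Ev` is injective**
  (Ayoub's Conjecture 7 as printed, for this calculus);
* `ayoubPiLocalKernel_iff_injective_away` — the same for the route decl of item 0541.

Nothing conjecture-grade is asserted: all statements are equivalences or the existence of the
extension. References: Ayoub 2014 (loc. cit.); M. Kontsevich, D. Zagier, *Periods* (2001), §4.1
("`P̂ = P[(2πi)⁻¹]`"); A. Huber, S. Müller-Stach, *Periods and Nori Motives* (2017), Def. 13.1.1 and
Conj. 13.2.1. Mathlib: `IsLocalization.map_eq_zero_iff`, `IsLocalization.mk'_surjective`,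
`IsLocalization.Away.lift`. No definition is introduced.
-/

noncomputable section

open Literature.NumberTheory.Transcendental

namespace Summit.KontsevichZagierPeriods.LiouvilleUnfolding.PiLocalKernelPosition

open Summit.KontsevichZagierPeriods.KontsevichZagierPeriods.Theses.LiouvilleUnfolding
  (AyoubPiLocalKernel)

/-! ## Bookkeeping: iterated multiplication by `[π]` becomes a power of its class -/

/-- In `P = FormalRep ⧸ relations`, the class of the left-nested iterate `([π] * ·)^[N] c` is
`p ^ N * ⟦c⟧`, `p = ⟦[π]⟧`. [folklore] -/
theorem toFormalPeriod_iterate_piRep_mul (N : ℕ) (c : KZ.FormalRep) :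
    KZ.toFormalPeriod ((fun x => KZ.of KZ.piRep * x)^[N] c) =
      KZ.toFormalPeriod (KZ.of KZ.piRep) ^ N * KZ.toFormalPeriod c := by
  induction N with
  | zero => simp
  | succ N ih => rw [Function.iterate_succ_apply', map_mul, ih, pow_succ', mul_assoc]

/-- The class of the disc does not evaluate to zero: `evalP ⟦[π]⟧ = π ≠ 0`. [folklore] -/
theorem evalP_piClass_ne_zero : KZ.evalP (KZ.toFormalPeriod (KZ.of KZ.piRep)) ≠ 0 := by
  rw [KZ.evalP_toFormalPeriod, KZ.eval_of, KZ.piRep_value]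
  exact Real.pi_ne_zero

/-- Soundness in `P`: if `p ^ N * x = 0` then `evalP x = 0` (`evalP` is a ring map to the domain `ℝ`
and `evalP p = π ≠ 0`). [folklore] -/
theorem evalP_eq_zero_of_pow_mul_eq_zero {N : ℕ} {x : KZ.FormalPeriodRing}
    (h : KZ.toFormalPeriod (KZ.of KZ.piRep) ^ N * x = 0) : KZ.evalP x = 0 := by
  have h' := congrArg KZ.evalP h
  rw [map_mul, map_pow, map_zero] at h'
  exact (mul_eq_zero.mp h').resolve_left (pow_ne_zero N evalP_piClass_ne_zero)

/-! ## The item in the formal period ring: the kernel of evaluation is `[π]`-power torsion -/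

/-- **`KZ.PiLocalKernel` in `P`**: every class of value `0` is killed by a power of `p = ⟦[π]⟧`.
(`toFormalPeriod` is surjective and multiplicative, `⟦·⟧ = 0 ↔ · ∈ relations`.)
[cite: Ayoub2014, Def. 6 and Conj. 7] -/
theorem piLocalKernel_iff_forall_evalP :
    KZ.PiLocalKernel ↔ ∀ x : KZ.FormalPeriodRing, KZ.evalP x = 0 →
      ∃ N : ℕ, KZ.toFormalPeriod (KZ.of KZ.piRep) ^ N * x = 0 := by
  constructor
  · intro h x hx
    obtain ⟨c, rfl⟩ := KZ.toFormalPeriod_surjective x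
    rw [KZ.evalP_toFormalPeriod] at hx
    obtain ⟨N, hN⟩ := h c hx
    exact ⟨N, by rw [← toFormalPeriod_iterate_piRep_mul, KZ.toFormalPeriod_eq_zero_iff]; exact hN⟩
  · intro h c hc
    obtain ⟨N, hN⟩ := h (KZ.toFormalPeriod c) (by rwa [KZ.evalP_toFormalPeriod])
    exact ⟨N, by rw [← KZ.toFormalPeriod_eq_zero_iff, toFormalPeriod_iterate_piRep_mul]; exact hN⟩

/-- **`KZ.PiLocalKernel ↔ ker evalP = ker (P → P[p⁻¹])`**: the conjecture says that the classes of
value `0` are exactly those that vanish when the disc is inverted (`IsLocalization.map_eq_zero_iff`: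
`x ↦ 0` in `P[p⁻¹]` iff some power of `p` kills `x`); the inclusion `⊇` is soundness.
[cite: Ayoub2014, Def. 6 and Conj. 7] -/
theorem piLocalKernel_iff_ker_evalP_eq_ker_algebraMap :
    KZ.PiLocalKernel ↔ RingHom.ker KZ.evalP =
      RingHom.ker (algebraMap KZ.FormalPeriodRing
        (Localization.Away (KZ.toFormalPeriod (KZ.of KZ.piRep)))) := by
  rw [piLocalKernel_iff_forall_evalP]
  constructor
  · intro h
    ext x
    rw [RingHom.mem_ker, RingHom.mem_ker,
      IsLocalization.map_eq_zero_iff (Submonoid.powers (KZ.toFormalPeriod (KZ.of KZ.piRep)))]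
    constructor
    · intro hx
      obtain ⟨N, hN⟩ := h x hx
      exact ⟨⟨_, N, rfl⟩, hN⟩
    · rintro ⟨⟨m, N, rfl⟩, hm⟩
      exact evalP_eq_zero_of_pow_mul_eq_zero hm
  · intro h x hx
    have hx' : x ∈ RingHom.ker (algebraMap KZ.FormalPeriodRing
        (Localization.Away (KZ.toFormalPeriod (KZ.of KZ.piRep)))) := by
      rw [← h]; exact hx
    rw [RingHom.mem_ker,
      IsLocalization.map_eq_zero_iff (Submonoid.powers (KZ.toFormalPeriod (KZ.of KZ.piRep)))] at hx'
    obtain ⟨⟨m, N, rfl⟩, hm⟩ := hx'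
    exact ⟨N, hm⟩

/-! ## Ayoub's Conjecture 7 as printed: `Ev : P[p⁻¹] → ℝ` is injective -/

/-- **The evaluation extends to the localised ring**: since `evalP p = π` is a unit of `ℝ`, there is a
ring map `Ev : P[p⁻¹] →+* ℝ` with `Ev ∘ (P → P[p⁻¹]) = evalP` (`IsLocalization.Away.lift`; it is unique
by `IsLocalization.ringHom_ext`). [cite: Ayoub2014, Def. 6 (the evaluation homomorphism (5))] -/
theorem exists_ringHom_away_comp_eq_evalP :
    ∃ Ev : Localization.Away (KZ.toFormalPeriod (KZ.of KZ.piRep)) →+* ℝ,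
      Ev.comp (algebraMap KZ.FormalPeriodRing _) = KZ.evalP :=
  ⟨IsLocalization.Away.lift (KZ.toFormalPeriod (KZ.of KZ.piRep))
      (isUnit_iff_ne_zero.mpr evalP_piClass_ne_zero),
    IsLocalization.Away.lift_comp _ _⟩

/-- **`KZ.PiLocalKernel ↔` Ayoub's Conjecture 7 for this calculus**: every (equivalently: the) ring
map `Ev : P[p⁻¹] →+* ℝ` extending `evalP` is injective. `→`: write `y = ⟦x⟧ / p ^ n`; `Ev y = 0` forces
`evalP x = 0`, so `p ^ N * x = 0` for some `N`, so `x ↦ 0` in `P[p⁻¹]` and `y = 0`. `←`: `evalP x = 0`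
gives `Ev (x / 1) = 0`, hence `x / 1 = 0`, i.e. a power of `p` kills `x`; an extension exists by
`exists_ringHom_away_comp_eq_evalP`. [cite: Ayoub2014, Conj. 7] -/
theorem piLocalKernel_iff_injective_away :
    KZ.PiLocalKernel ↔ ∀ Ev : Localization.Away (KZ.toFormalPeriod (KZ.of KZ.piRep)) →+* ℝ,
      Ev.comp (algebraMap KZ.FormalPeriodRing _) = KZ.evalP → Function.Injective Ev := by
  set p := KZ.toFormalPeriod (KZ.of KZ.piRep) with hp
  constructor
  · intro h Ev hEv
    rw [piLocalKernel_iff_forall_evalP] at h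
    rw [injective_iff_map_eq_zero]
    intro y hy
    obtain ⟨⟨x, s⟩, rfl⟩ := IsLocalization.mk'_surjective (Submonoid.powers p) y
    have hcomp : ∀ a, Ev (algebraMap KZ.FormalPeriodRing (Localization.Away p) a) = KZ.evalP a :=
      fun a => by rw [← hEv]; rfl
    -- `y = x/s = (x/1) * (1/s)` and `1/s` is a unit
    have hunit : IsUnit (IsLocalization.mk' (Localization.Away p) (1 : KZ.FormalPeriodRing) s) := by
      refine IsUnit.of_mul_eq_one (algebraMap KZ.FormalPeriodRing (Localization.Away p) s) ?_
      rw [IsLocalization.mk'_spec, map_one]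
    have hy' : KZ.evalP x = 0 := by
      simp only at hy
      rw [IsLocalization.mk'_eq_mul_mk'_one, map_mul, hcomp] at hy
      rcases mul_eq_zero.mp hy with h0 | h0
      · exact h0
      · exact absurd h0 (hunit.map Ev).ne_zero
    obtain ⟨N, hN⟩ := h x hy'
    have hx0 : algebraMap KZ.FormalPeriodRing (Localization.Away p) x = 0 := by
      rw [IsLocalization.map_eq_zero_iff (Submonoid.powers p)]
      exact ⟨⟨_, N, rfl⟩, hN⟩
    simp only
    rw [IsLocalization.mk'_eq_mul_mk'_one, hx0, zero_mul]
  · intro h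
    obtain ⟨Ev, hEv⟩ := exists_ringHom_away_comp_eq_evalP
    have hinj := h Ev hEv
    rw [piLocalKernel_iff_forall_evalP]
    intro x hx
    have h0 : Ev (algebraMap KZ.FormalPeriodRing (Localization.Away p) x) = 0 := by
      rw [← hx, ← hEv]; rfl
    rw [← map_zero Ev] at h0
    have hx0 := hinj h0
    rw [IsLocalization.map_eq_zero_iff (Submonoid.powers p)] at hx0
    obtain ⟨⟨m, N, rfl⟩, hm⟩ := hx0
    exact ⟨N, hm⟩

/-- **Item 0541 is Ayoub's Conjecture 7 for this calculus**: the route decl `AyoubPiLocalKernel`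
(interface typing) holds iff every ring map `P[⟦[π]⟧⁻¹] →+* ℝ` extending the evaluation is injective.
[cite: Ayoub2014, Conj. 7] -/
theorem ayoubPiLocalKernel_iff_injective_away :
    AyoubPiLocalKernel ↔ ∀ Ev : Localization.Away (KZ.toFormalPeriod (KZ.of KZ.piRep)) →+* ℝ,
      Ev.comp (algebraMap KZ.FormalPeriodRing _) = KZ.evalP → Function.Injective Ev :=
  Summit.KontsevichZagierPeriods.KernelForm.LocaliseAtValuePrime.ayoubPiLocalKernel_iff_piLocalKernel.trans
    piLocalKernel_iff_injective_away

/-- **Item 0541 in the formal period ring**: `AyoubPiLocalKernel ↔ ker evalP = ker (P → P[⟦[π]⟧⁻¹])`.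
[cite: Ayoub2014, Def. 6 and Conj. 7] -/
theorem ayoubPiLocalKernel_iff_ker_evalP_eq_ker_algebraMap :
    AyoubPiLocalKernel ↔ RingHom.ker KZ.evalP =
      RingHom.ker (algebraMap KZ.FormalPeriodRing
        (Localization.Away (KZ.toFormalPeriod (KZ.of KZ.piRep)))) :=
  Summit.KontsevichZagierPeriods.KernelForm.LocaliseAtValuePrime.ayoubPiLocalKernel_iff_piLocalKernel.trans
    piLocalKernel_iff_ker_evalP_eq_ker_algebraMap

end Summit.KontsevichZagierPeriods.LiouvilleUnfolding.PiLocalKernelPosition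

end
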